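import Summits.BirchSwinnertonDyer.BirchSwinnertonDyer.Theorems.EisensteinPrimesAnalyticLambdaSumCount
import Summits.BirchSwinnertonDyer.Rank1Residual.X1.RankOneParitySqueezeLeaf
import HarnessLib

/-!
# Route `EisensteinPrimes` (line `mudescent`, cruxes 3/5) × row A1: a PLANE-SUM value congruence whose
# unique least order is `1`, on the RANK-ONE LEAF, gives Mazur's main conjecture AND `BSD(E,p)` through
# route P₁ (`X1.RankOne.Leaf.mazurMainConjecture_and_bsdp_of_muZero_lamOne`; helper; TWO THEOREMS)

Seat `bsd-eis-lam-a` g11 (PROGRAMME PART 1b, ACCEL-LIST (4): ANALYTIC side of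
`stub_lambdaCount_offLocus`; items stmt-BirchSwinnertonDyer-19033 / -19035; owner bsd-eis-ky). No
definition, no named fact, nothing about any particular curve; closes nothing; moves no label.

WHAT AND WHY (HOME/lam-a-g11/lam-a-MEMO-11.md §3b–§3c; the g10 sibling
`EisensteinPrimesAnalyticLambdaAbsoluteCountRouteP` = p575803 did this for THEOREM B′'s ONE-term unit
congruence). THEOREMS C / C^mix / C^oth (MEMO-10 §3b, MEMO-11 §3b–§3c) deliver, at a type-A étale end
`W` of squarefree conductor with COMPOSITE Kummer support (one Eisenstein-type prime `q₁` with Mazur's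
goodness, plus non-split partners `≡ −1 (mod p)` or — at `p = 3` — arbitrary partners with a realiser of
the complementary class), a value congruence of the shape `G_W ≡ c·Σ_i A_i (mod p)` with plane terms
`A_i ∈ Λ` whose reduced orders have a UNIQUE minimum `a` (the Eisenstein plane's
`Σ_{split ℓ ∉ {p,q₁}} s_ℓ`); hence `μ_an(W) = 0 ∧ λ_an(W) = a` by
`EisensteinPrimesAnalyticLambdaSumCount.X1.analyticMuLE_zero_and_analyticLambdaEq_of_valueCongr_sum`
(p591898). On the RANK-ONE LEAF of X1 (row A1: good anomalous type A, `r = 1`) the b2b door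
`X1.RankOne.Leaf.mazurMainConjecture_and_bsdp_of_muZero_lamOne` turns `μ_an = 0 ∧ λ_an = 1` into
MAZUR'S MAIN CONJECTURE ∧ `BSD(E,p)` from PUBLISHED named facts only (Wuthrich Thm. 16, Perrin-Riou–
Schneider, Perrin-Riou 1987, Mazur–Tate sigma, modularity, GZK). This file is the composition for
`a = 1`: `X1.RankOne.Leaf.mazurMainConjecture_and_bsdp_of_valueCongr_sum_of_order_one` (any finite
index set) and its two-term form `…_of_valueCongr_add_of_order_one`. Census bearing (MEMO-11 §3b–§3c,
kit j295799 / j295973 pre-registered): 65 + 4 THEOREM C^mix cells and 126 THEOREM C^oth cells of row A1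
(`N < 5·10⁵`) have predicted `λ_an = 1` — there the per-pair two-engine certificate is replaced by a
theorem on paper + this kernel composition, exactly as for the 145 cells of p575803.

HONEST FRAMING. The congruence (`hval`) with its order data is what THEOREMS C^mix / C^oth PROVE ON
PAPER (modulo Mazur 1977 II §16–18 / III §8, Vatsal 2005 Thm. 1.1, Ohta 2014 (3.6.2) / Yoo 2023,
THEOREM A⁺ of MEMO-8 and the census realisers); it is NOT asserted here. The six named facts are the
door's, PUBLISHED, taken as hypotheses exactly as the door does (conditional-result shape of record).

References: [Mazur1977] III Cor. (8.5); [Wuthrich2014] Thm. 16; [BalakrishnanMullerStein2015] Thm. 1.7;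
[PerrinRiou1987] §1.4 Cor. 1.8; [GreenbergVatsal2000] §1 (9)–(10); MEMO-11 §3b–§3c.
-/

set_option linter.dupNamespace false
set_option autoImplicit false

noncomputable section

open scoped Classical MatrixGroups ModularForm

open PowerSeries CongruenceSubgroup WeierstrassCurve NumberField IsDedekindDomain
  Literature.NumberTheory.EllipticCurves
  Literature.NumberTheory.EllipticCurves.ModularForms
  Literature.NumberTheory.EllipticCurves.Rank1Residual
  Literature.NumberTheory.EllipticCurves.GreenbergVatsal2000
  Literature.NumberTheory.EllipticCurves.Greenberg1999
  Summit.BirchSwinnertonDyer.Rank1Residual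
  Summit.BirchSwinnertonDyer.Rank1Residual.X1.MuLambda
  Summit.BirchSwinnertonDyer.Rank1Residual.X1.MuPart
  Summit.BirchSwinnertonDyer.Rank1Residual.X1.ParitySqueeze
  Summit.BirchSwinnertonDyer.Rank1Residual.X1.RankOneParitySqueeze
  Summit.BirchSwinnertonDyer.Rank1Residual.X11a
  Summit.BirchSwinnertonDyer.Rank1Residual.Iwasawa
  Summit.BirchSwinnertonDyer.BirchSwinnertonDyer.Theorems
  Summit.BirchSwinnertonDyer.BirchSwinnertonDyer.Theorems.Rank1ResidualX1Defs
  Summit.BirchSwinnertonDyer.BirchSwinnertonDyer.Theorems.EisensteinPrimesAnalyticLambdaSumCount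

namespace Summit.BirchSwinnertonDyer.BirchSwinnertonDyer.Theorems.EisensteinPrimesAnalyticLambdaSumCountRouteP

variable {p : ℕ} [hp : Fact p.Prime]
  {W : WeierstrassCurve ℚ} [W.IsElliptic] [W.IsGloballyMinimal] [NeZero (W.conductorNorm ℤ)]
  {f : CuspForm (Gamma0 (W.conductorNorm ℤ)) 2} {ϖ : ℚ}

/-- **Route P₁ fed by a plane-sum congruence of least order `1` (THEOREMS C / C^mix / C^oth): Mazur's
main conjecture ∧ `BSD(E,p)` at a rank-one leaf pair.** On the rank-one leaf `X1.RankOne.Leaf W p`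
(row A1: good anomalous type A, `ord_{s=1} L(E,s) = 1`), granted the door's PUBLISHED facts Wuthrich
2014 Thm. 16 (`hW16`), Perrin-Riou–Schneider at odd `p` (`hS`), Perrin-Riou 1987 (`hPR`), the
Mazur–Tate sigma function (`hMT`), modularity (`hmod`), Gross–Zagier–Kolyvagin (`hGZK`): ONE datum
`(f, ϖ, G)` (`ι(G) = ϖ·L_p(f, α)`), plane terms `A : ι → Λ` on a finite set `s` with
`ord_T Ā_{i₀} = 1` (`i₀ ∈ s`: the Eisenstein plane raised by exactly one split prime with `p ∤ f_ℓ`) and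
`1 < ord_T Ā_i` for the other `i ∈ s` (the partners' planes), one unit `c ∈ ℤ_p` and the value
congruence `‖(G − C(c)·Σ_{i∈s} A_i)(ζ−1)‖ ≤ 1/p` at all primitive `p^{m+1}`-th roots of unity, `m ≥ n₀`
⟹ `MazurMainConjecture W p ∧ BSDp W p`. No `p`-adic height, no descent, no `#Ш_an`, no per-pair
`λ`-reading enters. [cite: Mazur1977, III Cor. (8.5)] [cite: Wuthrich2014, Thm. 16 (p. 393)]
[cite: BalakrishnanMullerStein2015, Thm. 1.7] [cite: PerrinRiou1987, §1.4 Cor. 1.8]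
[cite: GreenbergVatsal2000, §1 (9)–(10)] -/
theorem X1.RankOne.Leaf.mazurMainConjecture_and_bsdp_of_valueCongr_sum_of_order_one {ι : Type*}
    (hW16 : Wuthrich2014.charIdeal_dvd_padicLFunction) (hS : Schneider1985_order_charGenerator_odd)
    (hPR : perrinRiou_rankOne_leadingTerms_odd) (hMT : mazur_tate_sigma_exists_odd)
    (hmod : nonempty_modularParametrizationData) (hGZK : rank_eq_analyticRank_of_analyticRank_le_one)
    (hL : X1.RankOne.Leaf W p)
    (hf : IsNewformOf W f) (hϖ : (ϖ : ℝ) * W.realPeriodRat = plusPeriod f) {G : IwasawaAlgebra p}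
    (hG : iwasawaToPowerSeries p G =
      PowerSeries.C (ϖ : ℚ_[p]) * padicLFunction f (unitRoot W p : ℚ_[p]))
    (s : Finset ι) (A : ι → IwasawaAlgebra p) {i₀ : ι} (hi₀ : i₀ ∈ s)
    (h1 : (PowerSeries.map (PadicInt.toZMod (p := p)) (A i₀)).order = (1 : ℕ))
    (hlt : ∀ i ∈ s, i ≠ i₀ →
      ((1 : ℕ) : ℕ∞) < (PowerSeries.map (PadicInt.toZMod (p := p)) (A i)).order)
    {c : ℤ_[p]} (hc : IsUnit c) {n₀ : ℕ}
    (hval : ∀ m : ℕ, n₀ ≤ m → ∀ ζ : ℂ_[p], IsPrimitiveRoot ζ (p ^ (m + 1)) →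
      ‖∑' k, ((algebraMap ℚ_[p] ℂ_[p]).comp (algebraMap ℤ_[p] ℚ_[p]))
          (PowerSeries.coeff k (G - PowerSeries.C c * ∑ i ∈ s, A i)) * (ζ - 1) ^ k‖ ≤ (p : ℝ)⁻¹) :
    MazurMainConjecture W p ∧ BSDp W p := by
  obtain ⟨hμ0, hlam⟩ :=
    EisensteinPrimesAnalyticLambdaSumCount.X1.analyticMuLE_zero_and_analyticLambdaEq_of_valueCongr_sum
      hf hϖ hG s A hi₀ h1 hlt hc hval
  exact hL.mazurMainConjecture_and_bsdp_of_muZero_lamOne hW16 hS hPR hMT hmod hGZK hμ0 hlam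

/-- **Two-plane form** (THEOREM C^mix with one Eisenstein prime and one non-split partner, or THEOREM
C^oth with one composite partner plane): `ord_T Ā = 1 < ord_T B̄` and the value congruence
`G ≡ c·(A + B)` ⟹ `MazurMainConjecture W p ∧ BSDp W p` on the rank-one leaf.
[cite: Mazur1977, III Cor. (8.5)] [cite: Wuthrich2014, Thm. 16 (p. 393)]
[cite: BalakrishnanMullerStein2015, Thm. 1.7] [cite: PerrinRiou1987, §1.4 Cor. 1.8] -/
theorem X1.RankOne.Leaf.mazurMainConjecture_and_bsdp_of_valueCongr_add_of_order_one
    (hW16 : Wuthrich2014.charIdeal_dvd_padicLFunction) (hS : Schneider1985_order_charGenerator_odd)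
    (hPR : perrinRiou_rankOne_leadingTerms_odd) (hMT : mazur_tate_sigma_exists_odd)
    (hmod : nonempty_modularParametrizationData) (hGZK : rank_eq_analyticRank_of_analyticRank_le_one)
    (hL : X1.RankOne.Leaf W p)
    (hf : IsNewformOf W f) (hϖ : (ϖ : ℝ) * W.realPeriodRat = plusPeriod f) {G : IwasawaAlgebra p}
    (hG : iwasawaToPowerSeries p G =
      PowerSeries.C (ϖ : ℚ_[p]) * padicLFunction f (unitRoot W p : ℚ_[p]))
    {A B : IwasawaAlgebra p}
    (h1 : (PowerSeries.map (PadicInt.toZMod (p := p)) A).order = (1 : ℕ))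
    (hB : ((1 : ℕ) : ℕ∞) < (PowerSeries.map (PadicInt.toZMod (p := p)) B).order)
    {c : ℤ_[p]} (hc : IsUnit c) {n₀ : ℕ}
    (hval : ∀ m : ℕ, n₀ ≤ m → ∀ ζ : ℂ_[p], IsPrimitiveRoot ζ (p ^ (m + 1)) →
      ‖∑' k, ((algebraMap ℚ_[p] ℂ_[p]).comp (algebraMap ℤ_[p] ℚ_[p]))
          (PowerSeries.coeff k (G - PowerSeries.C c * (A + B))) * (ζ - 1) ^ k‖ ≤ (p : ℝ)⁻¹) :
    MazurMainConjecture W p ∧ BSDp W p := by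
  obtain ⟨hμ0, hlam⟩ :=
    EisensteinPrimesAnalyticLambdaCompositeCount.X1.analyticMuLE_zero_and_analyticLambdaEq_of_valueCongr_add
      hf hϖ hG h1 hB hc hval
  exact hL.mazurMainConjecture_and_bsdp_of_muZero_lamOne hW16 hS hPR hMT hmod hGZK hμ0 hlam

end Summit.BirchSwinnertonDyer.BirchSwinnertonDyer.Theorems.EisensteinPrimesAnalyticLambdaSumCountRouteP

end
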